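import Summits.Ventures.Crystal3D.Theorems.StickyWulffConstantCoaxialWallLawRiserCount
import HarnessLib

/-!
# The riser count under the crux's co-axiality hypothesis (top grain, by reflection)

HONEST FRAMING. Part of the venture `Summits/Ventures/Crystal3D` (cell `crystal3d-full`), helper
`--supports` the crux `CoaxialWallLaw` (stmt-Ventures-19481, `route-Ventures-StickyWulffConstant`),
REGISTERED line `WallLedgerF` (planner cf-p1 gen 16), stub `stub_coaxialTwoSlabAdhesion`.
Mirror image of `coaxial_inPlane_vacancies` (`…CoaxialWallLawRiserCount`, bottom grain): the
reflection `M : (x, y, z) ↦ (x, y, h − z)` of the cell swaps the two clamped windows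
`[−2R₀, −R₀] ↔ [h + R₀, h + 2R₀]`, preserves lateral radii, distances, moved fcc lattices,
co-axial presentations (frame `L ↦ S∘L`, `S` the reflection in the basal coordinate plane, same
`⟪·e₃, e₃⟫²`) and slot vacancies (`M(x + w) = M x + S w`).  Hence:

**Theorem (`coaxial_inPlane_vacancies_top`).**  If the TOP grain `A₂·Λ₀ + t₂` is presented
co-axially, `A₂·Λ₀ + t₂ ⊆ L·B(σ') + s₂`, the grains are disjoint and the unit packing `X` contains
both complete clamped slabs (`ρ ≥ R₀ ≥ 3`), then
`√6 · √(1 − ⟪L e₃, e₃⟫²) · π ρ² − 3√2 π (6R₀+16)(1+h) ρ ≤ Σ_{w ∈ {±L u, ±L v, ±L(v−u)}} #{x ∈ X ∩ grain 2 : x + w ∉ X}`.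
Together with the bottom-grain statement: a co-axial wall forces `≥ 2√6 sin θ · πρ² − C(1+h)ρ`
vacant in-plane slots on the two grains (the riser COUNT of the ledger, for any filling).
WHAT THIS IS NOT: the absorption inequality; the stub; rung F-C1 not moved.
-/

noncomputable section

namespace Summit.Ventures.Crystal3D.Theorems

open Summit.Ventures.Crystal3D Finset
open Literature.MathematicalPhysics.StatisticalMechanics (barlowStacking fccStacking IsHaggSeq
  triangularVec₁ triangularVec₂)
open scoped InnerProductSpace

/-- **The riser count under the crux's hypothesis (top grain).**  See the module docstring. -/
theorem coaxial_inPlane_vacancies_top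
    (A₁ : EuclideanSpace ℝ (Fin 3) ≃ₗᵢ[ℝ] EuclideanSpace ℝ (Fin 3)) (t₁ : EuclideanSpace ℝ (Fin 3))
    (A₂ : EuclideanSpace ℝ (Fin 3) ≃ₗᵢ[ℝ] EuclideanSpace ℝ (Fin 3)) (t₂ : EuclideanSpace ℝ (Fin 3))
    [DecidablePred fun p : EuclideanSpace ℝ (Fin 3) =>
      p ∈ (fun q => A₂ q + t₂) '' fccStacking 1 (Real.sqrt (2 / 3))]
    (L : EuclideanSpace ℝ (Fin 3) ≃ₗᵢ[ℝ] EuclideanSpace ℝ (Fin 3)) (s₂ : EuclideanSpace ℝ (Fin 3))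
    {σ' : ℤ → ℤ} (hσ' : IsHaggSeq σ')
    (hsub : (fun p => A₂ p + t₂) '' fccStacking 1 (Real.sqrt (2 / 3)) ⊆
      (fun p => L p + s₂) '' barlowStacking 1 (Real.sqrt (2 / 3)) σ')
    (X : Finset (EuclideanSpace ℝ (Fin 3)))
    (hX : ∀ p ∈ X, ∀ q ∈ X, p ≠ q → 1 ≤ dist p q)
    (R₀ h ρ : ℝ) (hR₀ : 3 ≤ R₀) (hh : 0 ≤ h) (hρ : R₀ ≤ ρ)
    (hP₁ : ∀ p ∈ (fun q => A₁ q + t₁) '' fccStacking 1 (Real.sqrt (2 / 3)),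
      -(2 * R₀) ≤ p 2 → p 2 ≤ -R₀ → p 0 ^ 2 + p 1 ^ 2 ≤ ρ ^ 2 → p ∈ X)
    (hP₂ : ∀ p ∈ (fun q => A₂ q + t₂) '' fccStacking 1 (Real.sqrt (2 / 3)),
      h + R₀ ≤ p 2 → p 2 ≤ h + 2 * R₀ → p 0 ^ 2 + p 1 ^ 2 ≤ ρ ^ 2 → p ∈ X)
    (hdisj : ∀ p ∈ (fun q => A₁ q + t₁) '' fccStacking 1 (Real.sqrt (2 / 3)),
      p ∉ (fun q => A₂ q + t₂) '' fccStacking 1 (Real.sqrt (2 / 3))) :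
    Real.sqrt 6 * Real.sqrt (1 - ⟪L (EuclideanSpace.single (2 : Fin 3) (1 : ℝ)),
        EuclideanSpace.single (2 : Fin 3) (1 : ℝ)⟫_ℝ ^ 2) * Real.pi * ρ ^ 2 -
        3 * (Real.sqrt 2 * Real.pi * (6 * R₀ + 16) * (1 + h) * ρ) ≤
      (((X.filter fun p => p ∈ (fun q => A₂ q + t₂) '' fccStacking 1 (Real.sqrt (2 / 3))).filter
          fun p => p + L (triangularVec₁ 1) ∉ X).card : ℝ) +
      (((X.filter fun p => p ∈ (fun q => A₂ q + t₂) '' fccStacking 1 (Real.sqrt (2 / 3))).filter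
          fun p => p - L (triangularVec₁ 1) ∉ X).card : ℝ) +
      (((X.filter fun p => p ∈ (fun q => A₂ q + t₂) '' fccStacking 1 (Real.sqrt (2 / 3))).filter
          fun p => p + L (triangularVec₂ 1) ∉ X).card : ℝ) +
      (((X.filter fun p => p ∈ (fun q => A₂ q + t₂) '' fccStacking 1 (Real.sqrt (2 / 3))).filter
          fun p => p - L (triangularVec₂ 1) ∉ X).card : ℝ) +
      (((X.filter fun p => p ∈ (fun q => A₂ q + t₂) '' fccStacking 1 (Real.sqrt (2 / 3))).filter
          fun p => p + L (triangularVec₂ 1 - triangularVec₁ 1) ∉ X).card : ℝ) +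
      (((X.filter fun p => p ∈ (fun q => A₂ q + t₂) '' fccStacking 1 (Real.sqrt (2 / 3))).filter
          fun p => p - L (triangularVec₂ 1 - triangularVec₁ 1) ∉ X).card : ℝ) := by
  classical
  set e₃ : EuclideanSpace ℝ (Fin 3) := EuclideanSpace.single (2 : Fin 3) (1 : ℝ) with he₃
  -- the reflection `S : (x,y,z) ↦ (x,y,−z)` and the affine mirror `M p = S p + h e₃`
  set S : EuclideanSpace ℝ (Fin 3) ≃ₗᵢ[ℝ] EuclideanSpace ℝ (Fin 3) :=
    ((ℝ ∙ EuclideanSpace.single (2 : Fin 3) (1 : ℝ)).reflection).trans (LinearIsometryEquiv.neg ℝ)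
    with hS
  have hS_apply : ∀ p, S p = -((ℝ ∙ EuclideanSpace.single (2 : Fin 3) (1 : ℝ)).reflection p) := by
    intro p; rfl
  have hS0 : ∀ p : EuclideanSpace ℝ (Fin 3), S p 0 = p 0 := by
    intro p; rw [hS_apply, PiLp.neg_apply, (halfTurn_coord p).1, neg_neg]
  have hS1 : ∀ p : EuclideanSpace ℝ (Fin 3), S p 1 = p 1 := by
    intro p; rw [hS_apply, PiLp.neg_apply, (halfTurn_coord p).2.1, neg_neg]
  have hS2 : ∀ p : EuclideanSpace ℝ (Fin 3), S p 2 = -p 2 := by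
    intro p; rw [hS_apply, PiLp.neg_apply, (halfTurn_coord p).2.2]
  have hSS : ∀ p, S (S p) = p := by
    intro p
    ext l
    fin_cases l
    · simp only [Fin.zero_eta, Fin.isValue]; rw [hS0, hS0]
    · simp only [Fin.mk_one, Fin.isValue]; rw [hS1, hS1]
    · simp only [Fin.reduceFinMk, Fin.isValue]; rw [hS2, hS2, neg_neg]
  set c : EuclideanSpace ℝ (Fin 3) := h • e₃ with hc
  have hc0 : c 0 = 0 := by simp [hc, he₃]
  have hc1 : c 1 = 0 := by simp [hc, he₃]
  have hc2 : c 2 = h := by simp [hc, he₃]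
  let M : EuclideanSpace ℝ (Fin 3) → EuclideanSpace ℝ (Fin 3) := fun p => S p + c
  have hM0 : ∀ p, M p 0 = p 0 := by intro p; simp only [M, PiLp.add_apply, hS0, hc0, add_zero]
  have hM1 : ∀ p, M p 1 = p 1 := by intro p; simp only [M, PiLp.add_apply, hS1, hc1, add_zero]
  have hM2 : ∀ p, M p 2 = h - p 2 := by
    intro p; simp only [M, PiLp.add_apply, hS2, hc2]; ring
  have hMM : ∀ p, M (M p) = p := by
    intro p
    have hSc : S c = -c := by
      ext l; fin_cases l
      · simp only [Fin.zero_eta, Fin.isValue]; rw [hS0, PiLp.neg_apply, hc0, neg_zero]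
      · simp only [Fin.mk_one, Fin.isValue]; rw [hS1, PiLp.neg_apply, hc1, neg_zero]
      · simp only [Fin.reduceFinMk, Fin.isValue]; rw [hS2, PiLp.neg_apply]
    simp only [M, map_add, hSS, hSc]; abel
  have hMinj : Function.Injective M := fun p q hpq => by
    have := congrArg M hpq; rwa [hMM, hMM] at this
  have hMdist : ∀ p q, dist (M p) (M q) = dist p q := by
    intro p q; simp only [M, dist_add_right, LinearIsometryEquiv.dist_map]
  have hMadd : ∀ p w, M (p + w) = M p + S w := by
    intro p w; simp only [M, map_add]; abel
  -- mirrored grains are moved lattices / Barlow images with the reflected frames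
  have hMgrain : ∀ (A : EuclideanSpace ℝ (Fin 3) ≃ₗᵢ[ℝ] EuclideanSpace ℝ (Fin 3)) (t : EuclideanSpace ℝ (Fin 3))
      (B : Set (EuclideanSpace ℝ (Fin 3))),
      M '' ((fun q => A q + t) '' B) = (fun q => (A.trans S) q + M t) '' B := by
    intro A t B
    ext x
    simp only [Set.mem_image, LinearIsometryEquiv.trans_apply]
    constructor
    · rintro ⟨_, ⟨q, hq, rfl⟩, rfl⟩
      exact ⟨q, hq, by simp only [M, map_add]; abel⟩
    · rintro ⟨q, hq, rfl⟩
      exact ⟨A q + t, ⟨q, hq, rfl⟩, by simp only [M, map_add]; abel⟩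
  have hMmem : ∀ (A : EuclideanSpace ℝ (Fin 3) ≃ₗᵢ[ℝ] EuclideanSpace ℝ (Fin 3)) (t p : EuclideanSpace ℝ (Fin 3)),
      M p ∈ (fun q => (A.trans S) q + M t) '' fccStacking 1 (Real.sqrt (2 / 3)) ↔
        p ∈ (fun q => A q + t) '' fccStacking 1 (Real.sqrt (2 / 3)) := by
    intro A t p
    rw [← hMgrain]
    constructor
    · rintro ⟨p', hp', hpp'⟩; rwa [← hMinj hpp']
    · intro hp; exact ⟨p, hp, rfl⟩
  -- the mirrored packing
  set X' : Finset (EuclideanSpace ℝ (Fin 3)) := X.image M with hX'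
  have hmemX' : ∀ p, M p ∈ X' ↔ p ∈ X := by
    intro p
    rw [hX', mem_image]
    constructor
    · rintro ⟨q, hq, hqp⟩; rwa [← hMinj hqp]
    · intro hp; exact ⟨p, hp, rfl⟩
  have hX'pack : ∀ p ∈ X', ∀ q ∈ X', p ≠ q → 1 ≤ dist p q := by
    intro p hp q hq hpq
    obtain ⟨p₀, hp₀, rfl⟩ := mem_image.1 hp
    obtain ⟨q₀, hq₀, rfl⟩ := mem_image.1 hq
    rw [hMdist]
    exact hX p₀ hp₀ q₀ hq₀ (fun e => hpq (by rw [e]))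
  -- apply the bottom-grain theorem to the mirrored cell (grain 2 is now at the bottom)
  have hsub' : (fun q => (A₂.trans S) q + M t₂) '' fccStacking 1 (Real.sqrt (2 / 3)) ⊆
      (fun q => (L.trans S) q + M s₂) '' barlowStacking 1 (Real.sqrt (2 / 3)) σ' := by
    rw [← hMgrain, ← hMgrain]; exact Set.image_mono hsub
  have hP₁' : ∀ p ∈ (fun q => (A₂.trans S) q + M t₂) '' fccStacking 1 (Real.sqrt (2 / 3)),
      -(2 * R₀) ≤ p 2 → p 2 ≤ -R₀ → p 0 ^ 2 + p 1 ^ 2 ≤ ρ ^ 2 → p ∈ X' := by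
    intro p hp h1 h2 h3
    have hp' : M p ∈ (fun q => A₂ q + t₂) '' fccStacking 1 (Real.sqrt (2 / 3)) := by
      rw [← hMmem, hMM]; exact hp
    have := hP₂ (M p) hp' (by rw [hM2]; linarith) (by rw [hM2]; linarith) (by rw [hM0, hM1]; exact h3)
    rwa [← hmemX', hMM] at this
  have hP₂' : ∀ p ∈ (fun q => (A₁.trans S) q + M t₁) '' fccStacking 1 (Real.sqrt (2 / 3)),
      h + R₀ ≤ p 2 → p 2 ≤ h + 2 * R₀ → p 0 ^ 2 + p 1 ^ 2 ≤ ρ ^ 2 → p ∈ X' := by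
    intro p hp h1 h2 h3
    have hp' : M p ∈ (fun q => A₁ q + t₁) '' fccStacking 1 (Real.sqrt (2 / 3)) := by
      rw [← hMmem, hMM]; exact hp
    have := hP₁ (M p) hp' (by rw [hM2]; linarith) (by rw [hM2]; linarith) (by rw [hM0, hM1]; exact h3)
    rwa [← hmemX', hMM] at this
  have hdisj' : ∀ p ∈ (fun q => (A₂.trans S) q + M t₂) '' fccStacking 1 (Real.sqrt (2 / 3)),
      p ∉ (fun q => (A₁.trans S) q + M t₁) '' fccStacking 1 (Real.sqrt (2 / 3)) := by
    intro p hp hp1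
    have h2 : M p ∈ (fun q => A₂ q + t₂) '' fccStacking 1 (Real.sqrt (2 / 3)) := by
      rw [← hMmem, hMM]; exact hp
    have h1 : M p ∈ (fun q => A₁ q + t₁) '' fccStacking 1 (Real.sqrt (2 / 3)) := by
      rw [← hMmem, hMM]; exact hp1
    exact hdisj _ h1 h2
  have key := coaxial_inPlane_vacancies (A₂.trans S) (M t₂) (A₁.trans S) (M t₁) (L.trans S) (M s₂)
    hσ' hsub' X' hX'pack R₀ h ρ hR₀ hh hρ hP₁' hP₂' hdisj'
  -- the sine is unchanged
  have hsine : ⟪(L.trans S) e₃, e₃⟫_ℝ ^ 2 = ⟪L e₃, e₃⟫_ℝ ^ 2 := by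
    have e1 : ⟪(L.trans S) e₃, e₃⟫_ℝ = ((L.trans S) e₃) 2 := by
      rw [he₃, EuclideanSpace.inner_single_right]; simp
    have e2 : ⟪L e₃, e₃⟫_ℝ = (L e₃) 2 := by
      rw [he₃, EuclideanSpace.inner_single_right]; simp
    rw [e1, e2, LinearIsometryEquiv.trans_apply, hS2, neg_sq]
  rw [hsine] at key
  -- the counts are unchanged: `x ↦ M x` is a bijection matching the filters
  have hcount : ∀ w : EuclideanSpace ℝ (Fin 3),
      (((X'.filter fun p => p ∈ (fun q => (A₂.trans S) q + M t₂) '' fccStacking 1 (Real.sqrt (2 / 3))).filter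
          fun p => p + (L.trans S) w ∉ X').card : ℝ) =
      (((X.filter fun p => p ∈ (fun q => A₂ q + t₂) '' fccStacking 1 (Real.sqrt (2 / 3))).filter
          fun p => p + L w ∉ X).card : ℝ) := by
    intro w
    have himg : (((X.filter fun p => p ∈ (fun q => A₂ q + t₂) '' fccStacking 1 (Real.sqrt (2 / 3))).filter
        (fun p => p + L w ∉ X)).image M) =
        ((X'.filter fun p => p ∈ (fun q => (A₂.trans S) q + M t₂) '' fccStacking 1 (Real.sqrt (2 / 3))).filter
          fun p => p + (L.trans S) w ∉ X') := by
      ext x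
      simp only [mem_image, mem_filter]
      constructor
      · rintro ⟨p, ⟨⟨hpX, hpG⟩, hpw⟩, rfl⟩
        refine ⟨⟨(hmemX' p).2 hpX, (hMmem A₂ t₂ p).2 hpG⟩, ?_⟩
        rw [LinearIsometryEquiv.trans_apply, ← hMadd, hmemX']
        exact hpw
      · rintro ⟨⟨hxX, hxG⟩, hxw⟩
        refine ⟨M x, ⟨⟨?_, ?_⟩, ?_⟩, hMM x⟩
        · rw [← hmemX', hMM]; exact hxX
        · rw [← hMmem, hMM]; exact hxG
        · intro hc'
          apply hxw
          have e : x + (L.trans S) w = M (M x + L w) := by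
            rw [LinearIsometryEquiv.trans_apply, hMadd, hMM]
          rw [e, hmemX']
          exact hc'
    rw [← himg, card_image_of_injective _ hMinj]
  have hTn : ∀ (T : EuclideanSpace ℝ (Fin 3) ≃ₗᵢ[ℝ] EuclideanSpace ℝ (Fin 3))
      (w p : EuclideanSpace ℝ (Fin 3)), p - T w = p + T (-w) := by
    intro T w p; rw [map_neg, sub_eq_add_neg]
  simp only [hTn] at key ⊢
  rw [hcount, hcount, hcount, hcount, hcount, hcount] at key
  exact key

end Summit.Ventures.Crystal3D.Theorems

end
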